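import Literature.AnabelianGeometry.EtaleTheta.Discharge.Sec5SgpUniqueOfBiKummerData
import Literature.AnabelianGeometry.EtaleTheta.Discharge.Sec5Lem59iiOfConnectedTemperoidData
import Literature.AnabelianGeometry.EtaleTheta.Discharge.Sec5OfTemperoidModelData
import Literature.AnabelianGeometry.EtaleTheta.Discharge.Sec5TowerOfConnectedTemperoid

/-!
# [EtTh] §5 p. 331 (PDF p. 105): `SgpUnique` (F-0554) and the bi-Kummer rows (F-0551/F-0552/F-0553) BY NAME at every genuine §5 constructor

Mochizuki, *The étale theta function and its Frobenioid-theoretic manifestations*, Publ. RIMS **45** (2009)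
[cite: MochizukiEtTh2009, §5 p.331 (PDF p.105); Prop 4.3 (iii) p.317 (PDF p.91)].  abc-iut cell, block F (FACT-PROVING wave),
seat abc-iut-f-125 (gen 2; tranche 125: FACT-LIST rows **F-0551** `ThetaFrobenioid.BiKummerDifferenceMem`, **F-0552** `SgpCapSpec`,
**F-0553** `SgpCupSpec`, **F-0554** `SgpUnique`, trunk `FrobenioidThetaBiKummer.lean`).  PROOF-ONLY sequel of this seat's
`Discharge/Sec5SgpUniqueOfBiKummerData.lean` (gen 0, instance forms at `ofRootData` / `ofBiKummerData`): no `def`, no `Prop` fact,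
nothing landed is edited or restated — every conjunct that already has a name in the tree is CITED (abc-iut-L2-t4's
`sgpCapSpec_/sgpCupSpec_/biKummerDifferenceMem_…`, abc-iut-w4-d099's `…_ofConnectedTemperoidData`, abc-iut-w6-d054's
`biKummerDifferenceMem_ofConnectedTemperoid(Ydd)Data`, abc-iut-L2-t9 / abc-iut-w5-d019's `…_ofTemperoidData`).

The four rows are `parametrised` predicates on the DATA-ONLY interface `𝔉 : ThetaFrobenioid C D` (universal closures REFUTED,
abc-iut-w6-d043 `Sec5BiKummerSchemaVerdicts`; FACT-LIST rule R5: consumed at NAMED instances).  Before this file the uniqueness clause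
F-0554 — p. 331 "determines **unique** group homomorphisms `s^⊓-gp_N : Aut_D(B_N^bs) → Aut_C(B_N)`; `s^⊔-gp_N : H_{B_N} → Aut_C(B_N)`" —
had a name only at `ofRootData` / `ofBiKummerData` (p431700) and inside the bundle projection `Facts.sgpUnique` (which presupposes
the Lemma 5.8 input `ConstantsActByCyclotome`).  Here it is proved OUTRIGHT (total epimorphicity of the model Frobenioid,
[FrdI] Def. 1.3 / Thm. 5.2, `epi_of_model`, and abc-iut-L2-t4's `sgpUnique_of`) at the remaining genuine constructors, and the
TRANCHE-125 CERTIFICATE `SgpCapSpec ∧ SgpCupSpec ∧ SgpUnique ∧ BiKummerDifferenceMem` is assembled there by name: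

* `sgpUnique_ofConnectedTemperoidData`, `sgpSpecs_and_unique_ofConnectedTemperoidData` — the §5 data over the GENUINE connected base
  `B^temp(Π^tp_X)⁰` (`ThetaFrobenioid.ofConnectedTemperoidData`, abc-iut-w4-d099): NO named input;
  `biKummerRows_ofConnectedTemperoidData` — the certificate modulo the single printed input `hH` (`Π^tp_Ÿ ⊆ H_⊙`, p. 322);
  **`biKummerRows_ofConnectedTemperoidYddData`** — with `A_⊙^bs := Ÿ` (`mkOfConnectedTemperoidYdd`) the certificate has an
  EMPTY hypothesis list beyond the construction data (F-0551 conjunct = abc-iut-w6-d054's `biKummerDifferenceMem_ofConnectedTemperoidYddData`);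
  (F-0551 in PRINT's orientation `s^⊓-gp·(s^⊔-gp)⁻¹ ∈ μ_N(B_N)` at these data is abc-iut-w6-d053's
  `sgpCap_mul_sgpCup_inv_mem_muTorsion_ofConnectedTemperoid(Ydd)Data`, `Sec5Lem59iIffProp43iii.lean` — not repeated here).
* `sgpUnique_ofTemperoidData`, `sgpSpecs_and_unique_ofTemperoidData` (no input), `biKummerDifferenceMem_ofTemperoidData` /
  `biKummerRows_ofTemperoidData` (mod `hH`) — the §5 data over the tempered base `B^temp(Π^tp_X)` (`ThetaFrobenioid.ofTemperoidData`).
* `ThetaFrobenioidTower.sgpUnique_levelData` — F-0554 at EVERY level of the assembled tower of roots (`levelData N`, no input);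
  `biKummerRows_levelData` (inputs exactly those of abc-iut-L2-t4's `biKummerDifferenceMem_levelData`: `hσ`, `hH`, `hfrac`, `haut`);
  `sgpUnique_atLevel_ofConnectedTemperoidFamily` / `biKummerRows_atLevel_ofConnectedTemperoidFamily` — every level of the tower over
  `B^temp(Π^tp_X)⁰` (no input / mod `hH`).
HONEST FRAMING: kernel-checked consequences for data so constructed; nothing of [EtTh] is asserted unconditionally; a FACT row is an
assumption label; nothing here bears on [IUTchIII] Cor. 3.12 and no side is taken; typed ≠ proved. -/

noncomputable section

namespace Literature.AnabelianGeometry.EtaleTheta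

open CategoryTheory Opposite Literature.AlgebraicGeometry.Frobenioids Literature.AnabelianGeometry.SemiGraphs
  Literature.AnabelianGeometry.SemiGraphs.GaloisObjects

universe u₀ v₀ u v w

namespace ThetaFrobenioid

/-! ### Over the genuine connected base `B^temp(Π^tp_X)⁰` (`ofConnectedTemperoidData`) -/

section OfConnectedTemperoidData

variable {K : Type u₀} [Field K] {X : SemiGraphs.TemperedArithmeticGroup.{u₀} K} {D₀ : Type u₀} [Category.{v₀} D₀]
  {V : FrdIMonoidStub.{w}} {T₀ : RealifiedDivisorMonoids (D₀ := D₀) V}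
  {VD : FrdICatStub.{u₀ + 1, u₀, w} (ConnectedPart (BTemp X.Pi))}
  {tf : TemperedFrobenioid T₀ (ConnectedPart (BTemp X.Pi)) VD} {hZ : tf.monoidType = MonoidType.Z}
  {hP : ∀ A : (ConnectedPart (BTemp X.Pi))ᵒᵖ, IsPerfect (tf.Φ.carrier A)}
  {NH : Subgroup (Field.absoluteGaloisGroup K) → tf.category → ℕ+ → Prop} {A₀ : tf.category}
  {hA₀ : PreFrobenioid.IsFrobeniusTrivial tf.toElem A₀} {hA₀' : SemiGraphs.IsGaloisObj A₀.base.obj}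
  {pullFrac : ∀ {A A' : (BiKummerSetting.mkOfConnectedTemperoid X tf hZ hP NH A₀ hA₀ hA₀').C} (_ : A' ⟶ A),
    (BiKummerSetting.mkOfConnectedTemperoid X tf hZ hP NH A₀ hA₀ hA₀').biratUnits A →
      (BiKummerSetting.mkOfConnectedTemperoid X tf hZ hP NH A₀ hA₀ hA₀').biratUnits A'}
  {lv N : ℕ+} {T : ThetaEnvData.{max u₀ w} N}
  {θ : (BiKummerSetting.mkOfConnectedTemperoid X tf hZ hP NH A₀ hA₀ hA₀').biratUnits
    (BiKummerSetting.mkOfConnectedTemperoid X tf hZ hP NH A₀ hA₀ hA₀').Aodot}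
  {Bl : (BiKummerSetting.mkOfConnectedTemperoid X tf hZ hP NH A₀ hA₀ hA₀').C}
  {Pl : (BiKummerSetting.mkOfConnectedTemperoid X tf hZ hP NH A₀ hA₀ hA₀').FractionPair θ Bl}
  {Rl : (BiKummerSetting.mkOfConnectedTemperoid X tf hZ hP NH A₀ hA₀ hA₀').NthRoot θ Pl lv pullFrac}
  (h : ModelFrobenioid.Hypotheses tf.divisorMonoid tf.ratFnFunctor)
  (Q : FrobenioidTheta.ThetaSubquotientStub.{w} (ConnectedPart (BTemp X.Pi))) (odd_l : Odd (lv : ℕ))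
  (R : (BiKummerSetting.mkOfConnectedTemperoid X tf hZ hP NH A₀ hA₀ hA₀').NthRoot Rl.root Rl.pair N pullFrac)
  (ιX : T.PiX ≃ₜ* X.Pi) (K' : Type w) [Field K'] (constEmb : K'ˣ →* tf.biratUnitsModel R.BN)
  (constEmb_injective : Function.Injective constEmb)
  (hinvc : ∀ g : Aut R.AN.base,
    pull tf.divisorMonoid g.hom (ModelFrobenioid.div R.pair.num) = ModelFrobenioid.div R.pair.num)
  (hinvp : ∀ y : T.PiX, y ∈ T.PiYdd →
    pull tf.divisorMonoid ((BiKummerSetting.mkOfConnectedTemperoid X tf hZ hP NH A₀ hA₀ hA₀').galoisSurj R.AN.base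
      R.αData.isGalois (ιX y)).hom (ModelFrobenioid.div R.pair.den) = ModelFrobenioid.div R.pair.den)

/-- **F-0554 `SgpUnique` for the §5 data over the GENUINE connected base `B^temp(Π^tp_X)⁰`, NO named input** (p. 331 (PDF p. 105),
"determines unique group homomorphisms `s^⊓-gp_N`, `s^⊔-gp_N`"): `ofConnectedTemperoidData` IS `ofBiKummerData` with the discharged
arguments (`ofConnectedTemperoidData_eq`, definitional), so this seat's `sgpUnique_ofBiKummerData` (total epimorphicity of the model
Frobenioid, [FrdI] Def. 1.3 / Thm. 5.2) applies verbatim.  [cite: MochizukiEtTh2009, §5 p.331 (PDF p.105)] -/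
theorem sgpUnique_ofConnectedTemperoidData :
    (ofConnectedTemperoidData h Q odd_l R ιX K' constEmb constEmb_injective hinvc hinvp).SgpUnique :=
  sgpUnique_ofBiKummerData h _ Q odd_l R ιX _ _ K' constEmb constEmb_injective _ _

/-- **The p. 331 sentence in full over `B^temp(Π^tp_X)⁰`, NO named input**: the two defining relations HOLD (F-0552 `SgpCapSpec`,
F-0553 `SgpCupSpec` — abc-iut-w4-d099's theorems, cited) AND the homomorphisms satisfying them are unique (F-0554).
[cite: MochizukiEtTh2009, §5 p.331 (PDF p.105)] -/
theorem sgpSpecs_and_unique_ofConnectedTemperoidData :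
    (ofConnectedTemperoidData h Q odd_l R ιX K' constEmb constEmb_injective hinvc hinvp).SgpCapSpec ∧
    (ofConnectedTemperoidData h Q odd_l R ιX K' constEmb constEmb_injective hinvc hinvp).SgpCupSpec ∧
    (ofConnectedTemperoidData h Q odd_l R ιX K' constEmb constEmb_injective hinvc hinvp).SgpUnique :=
  ⟨sgpCapSpec_ofConnectedTemperoidData h Q odd_l R ιX K' constEmb constEmb_injective hinvc hinvp,
    sgpCupSpec_ofConnectedTemperoidData h Q odd_l R ιX K' constEmb constEmb_injective hinvc hinvp,
    sgpUnique_ofConnectedTemperoidData h Q odd_l R ιX K' constEmb constEmb_injective hinvc hinvp⟩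

/-- **Tranche-125 certificate over `B^temp(Π^tp_X)⁰` modulo the single printed input `hH`** (`Π^tp_Ÿ ⊆ H_⊙`, §5 p. 322 (PDF p. 96)):
all four FACT-LIST rows of `FrobenioidThetaBiKummer.lean` p. 331 — F-0552 `SgpCapSpec`, F-0553 `SgpCupSpec`, F-0554 `SgpUnique`,
F-0551 `BiKummerDifferenceMem` (abc-iut-w6-d054's `biKummerDifferenceMem_ofConnectedTemperoidData`, cited) — for `ofConnectedTemperoidData`.
[cite: MochizukiEtTh2009, §5 p.331 (PDF p.105); Prop 4.3 (iii) p.317 (PDF p.91)] -/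
theorem biKummerRows_ofConnectedTemperoidData
    (hH : ∀ y : T.PiX, y ∈ T.PiYdd → ιX y ∈ (BiKummerSetting.mkOfConnectedTemperoid X tf hZ hP NH A₀ hA₀ hA₀').Hodot) :
    (ofConnectedTemperoidData h Q odd_l R ιX K' constEmb constEmb_injective hinvc hinvp).SgpCapSpec ∧
    (ofConnectedTemperoidData h Q odd_l R ιX K' constEmb constEmb_injective hinvc hinvp).SgpCupSpec ∧
    (ofConnectedTemperoidData h Q odd_l R ιX K' constEmb constEmb_injective hinvc hinvp).SgpUnique ∧
    (ofConnectedTemperoidData h Q odd_l R ιX K' constEmb constEmb_injective hinvc hinvp).BiKummerDifferenceMem :=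
  ⟨sgpCapSpec_ofConnectedTemperoidData h Q odd_l R ιX K' constEmb constEmb_injective hinvc hinvp,
    sgpCupSpec_ofConnectedTemperoidData h Q odd_l R ιX K' constEmb constEmb_injective hinvc hinvp,
    sgpUnique_ofConnectedTemperoidData h Q odd_l R ιX K' constEmb constEmb_injective hinvc hinvp,
    biKummerDifferenceMem_ofConnectedTemperoidData h Q odd_l R ιX K' constEmb constEmb_injective hinvc hinvp hH⟩

end OfConnectedTemperoidData
/-! ### Over `B^temp(Π^tp_X)⁰` with `A_⊙^bs := Ÿ` (`mkOfConnectedTemperoidYdd`): the certificate with NO named input -/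

section OfConnectedTemperoidYddData

variable {K : Type u₀} [Field K] {X : SemiGraphs.TemperedArithmeticGroup.{u₀} K} {D₀ : Type u₀} [Category.{v₀} D₀]
  {V : FrdIMonoidStub.{w}} {T₀ : RealifiedDivisorMonoids (D₀ := D₀) V}
  {VD : FrdICatStub.{u₀ + 1, u₀, w} (ConnectedPart (BTemp X.Pi))}
  {tf : TemperedFrobenioid T₀ (ConnectedPart (BTemp X.Pi)) VD} {hZ : tf.monoidType = MonoidType.Z}
  {hP : ∀ A : (ConnectedPart (BTemp X.Pi))ᵒᵖ, IsPerfect (tf.Φ.carrier A)}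
  {NH : Subgroup (Field.absoluteGaloisGroup K) → tf.category → ℕ+ → Prop}
  {lv N : ℕ+} {T : ThetaEnvData.{max u₀ w} N} {ιX : T.PiX ≃ₜ* X.Pi}
  {pullFrac : ∀ {A A' : (BiKummerSetting.mkOfConnectedTemperoidYdd X tf hZ hP NH T ιX).C} (_ : A' ⟶ A),
    (BiKummerSetting.mkOfConnectedTemperoidYdd X tf hZ hP NH T ιX).biratUnits A →
      (BiKummerSetting.mkOfConnectedTemperoidYdd X tf hZ hP NH T ιX).biratUnits A'}
  {θ : (BiKummerSetting.mkOfConnectedTemperoidYdd X tf hZ hP NH T ιX).biratUnits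
    (BiKummerSetting.mkOfConnectedTemperoidYdd X tf hZ hP NH T ιX).Aodot}
  {Bl : (BiKummerSetting.mkOfConnectedTemperoidYdd X tf hZ hP NH T ιX).C}
  {Pl : (BiKummerSetting.mkOfConnectedTemperoidYdd X tf hZ hP NH T ιX).FractionPair θ Bl}
  {Rl : (BiKummerSetting.mkOfConnectedTemperoidYdd X tf hZ hP NH T ιX).NthRoot θ Pl lv pullFrac}
  (h : ModelFrobenioid.Hypotheses tf.divisorMonoid tf.ratFnFunctor)
  (Q : FrobenioidTheta.ThetaSubquotientStub.{w} (ConnectedPart (BTemp X.Pi))) (odd_l : Odd (lv : ℕ))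
  (R : (BiKummerSetting.mkOfConnectedTemperoidYdd X tf hZ hP NH T ιX).NthRoot Rl.root Rl.pair N pullFrac)
  (K' : Type w) [Field K'] (constEmb : K'ˣ →* tf.biratUnitsModel R.BN) (constEmb_injective : Function.Injective constEmb)
  (hinvc : ∀ g : Aut R.AN.base,
    pull tf.divisorMonoid g.hom (ModelFrobenioid.div R.pair.num) = ModelFrobenioid.div R.pair.num)
  (hinvp : ∀ y : T.PiX, y ∈ T.PiYdd →
    pull tf.divisorMonoid ((BiKummerSetting.mkOfConnectedTemperoidYdd X tf hZ hP NH T ιX).galoisSurj R.AN.base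
      R.αData.isGalois (ιX y)).hom (ModelFrobenioid.div R.pair.den) = ModelFrobenioid.div R.pair.den)

/-- **Tranche-125 certificate with an EMPTY hypothesis list beyond the construction data**: for the §5 data over the genuine connected
base `B^temp(Π^tp_X)⁰` with `A_⊙^bs := Ÿ`, all four FACT-LIST rows F-0552 `SgpCapSpec`, F-0553 `SgpCupSpec`, F-0554 `SgpUnique`,
F-0551 `BiKummerDifferenceMem` are THEOREMS of the data (`hH` is abc-iut-L2-t4's theorem `hH_mkOfConnectedTemperoidYdd`, consumed through
abc-iut-w6-d054's `biKummerDifferenceMem_ofConnectedTemperoidYddData`).  Inputs: `h` ([FrdI] Thm. 5.2 hypotheses of the model), `Q`, the roots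
`Rl`/`R`, the constants `constEmb`, the divisor invariances `hinvc` (p. 330) / `hinvp` (Prop. 4.3 (i) proof, p. 317) — no section hypothesis,
no dictionary law, no `Facts` bundle, no FACT-LIST name.  [cite: MochizukiEtTh2009, §5 p.331 (PDF p.105); Prop 4.3 (iii) p.317 (PDF p.91)] -/
theorem biKummerRows_ofConnectedTemperoidYddData :
    (ofConnectedTemperoidData h Q odd_l R ιX K' constEmb constEmb_injective hinvc hinvp).SgpCapSpec ∧
    (ofConnectedTemperoidData h Q odd_l R ιX K' constEmb constEmb_injective hinvc hinvp).SgpCupSpec ∧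
    (ofConnectedTemperoidData h Q odd_l R ιX K' constEmb constEmb_injective hinvc hinvp).SgpUnique ∧
    (ofConnectedTemperoidData h Q odd_l R ιX K' constEmb constEmb_injective hinvc hinvp).BiKummerDifferenceMem :=
  biKummerRows_ofConnectedTemperoidData h Q odd_l R ιX K' constEmb constEmb_injective hinvc hinvp
    (BiKummerSetting.hH_mkOfConnectedTemperoidYdd X tf hZ hP NH T ιX)

end OfConnectedTemperoidYddData
/-! ### Over the tempered base `B^temp(Π^tp_X)` (`ofTemperoidData`) -/

section OfTemperoidData

variable {K : Type u₀} [Field K] {X : SemiGraphs.TemperedArithmeticGroup.{u₀} K} {D₀ : Type u₀} [Category.{v₀} D₀]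
  {V : FrdIMonoidStub.{w}} {T₀ : RealifiedDivisorMonoids (D₀ := D₀) V} {VD : FrdICatStub.{u₀ + 1, u₀, w} (BTemp X.Pi)}
  {tf : TemperedFrobenioid T₀ (BTemp X.Pi) VD} {hZ : tf.monoidType = MonoidType.Z}
  {hP : ∀ A : (BTemp X.Pi)ᵒᵖ, IsPerfect (tf.Φ.carrier A)}
  {NH : Subgroup (Field.absoluteGaloisGroup K) → tf.category → ℕ+ → Prop} {A₀ : tf.category}
  {hA₀ : PreFrobenioid.IsFrobeniusTrivial tf.toElem A₀} {hA₀' : SemiGraphs.IsGaloisObj A₀.base}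
  {pullFrac : ∀ {A A' : (BiKummerSetting.mkOfTemperoid X tf hZ hP NH A₀ hA₀ hA₀').C} (_ : A' ⟶ A),
    (BiKummerSetting.mkOfTemperoid X tf hZ hP NH A₀ hA₀ hA₀').biratUnits A →
      (BiKummerSetting.mkOfTemperoid X tf hZ hP NH A₀ hA₀ hA₀').biratUnits A'}
  {lv N : ℕ+} {T : ThetaEnvData.{max u₀ w} N}
  {θ : (BiKummerSetting.mkOfTemperoid X tf hZ hP NH A₀ hA₀ hA₀').biratUnits
    (BiKummerSetting.mkOfTemperoid X tf hZ hP NH A₀ hA₀ hA₀').Aodot}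
  {Bl : (BiKummerSetting.mkOfTemperoid X tf hZ hP NH A₀ hA₀ hA₀').C}
  {Pl : (BiKummerSetting.mkOfTemperoid X tf hZ hP NH A₀ hA₀ hA₀').FractionPair θ Bl}
  {Rl : (BiKummerSetting.mkOfTemperoid X tf hZ hP NH A₀ hA₀ hA₀').NthRoot θ Pl lv pullFrac}
  (h : ModelFrobenioid.Hypotheses tf.divisorMonoid tf.ratFnFunctor)
  (Q : FrobenioidTheta.ThetaSubquotientStub.{w} (BTemp X.Pi)) (odd_l : Odd (lv : ℕ))
  (R : (BiKummerSetting.mkOfTemperoid X tf hZ hP NH A₀ hA₀ hA₀').NthRoot Rl.root Rl.pair N pullFrac)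
  (ιX : T.PiX ≃ₜ* X.Pi) (K' : Type w) [Field K'] (constEmb : K'ˣ →* tf.biratUnitsModel R.BN)
  (constEmb_injective : Function.Injective constEmb)
  (hinvc : ∀ g : Aut R.AN.base,
    pull tf.divisorMonoid g.hom (ModelFrobenioid.div R.pair.num) = ModelFrobenioid.div R.pair.num)
  (hinvp : ∀ y : T.PiX, y ∈ T.PiYdd →
    pull tf.divisorMonoid (galoisSurjOf X.isTempered R.AN.base R.αData.isGalois (ιX y)).hom
      (ModelFrobenioid.div R.pair.den) = ModelFrobenioid.div R.pair.den)

/-- **F-0554 `SgpUnique` for the §5 data over the GENUINE tempered base `B^temp(Π^tp_X)`, NO named input** (p. 331 (PDF p. 105)):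
`ofTemperoidData` IS `ofBiKummerData` with the discharged arguments (`ofTemperoidData_eq`, definitional).
[cite: MochizukiEtTh2009, §5 p.331 (PDF p.105)] -/
theorem sgpUnique_ofTemperoidData :
    (ofTemperoidData h Q odd_l R ιX K' constEmb constEmb_injective hinvc hinvp).SgpUnique :=
  sgpUnique_ofBiKummerData h _ Q odd_l R ιX _ _ K' constEmb constEmb_injective _ _

/-- **The p. 331 sentence in full over `B^temp(Π^tp_X)`, NO named input** (F-0552 ∧ F-0553 ∧ F-0554; the first two are
abc-iut-L2-t9 / abc-iut-w5-d019's `sgpCapSpec_ofTemperoidData` / `sgpCupSpec_ofTemperoidData`, cited).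
[cite: MochizukiEtTh2009, §5 p.331 (PDF p.105)] -/
theorem sgpSpecs_and_unique_ofTemperoidData :
    (ofTemperoidData h Q odd_l R ιX K' constEmb constEmb_injective hinvc hinvp).SgpCapSpec ∧
    (ofTemperoidData h Q odd_l R ιX K' constEmb constEmb_injective hinvc hinvp).SgpCupSpec ∧
    (ofTemperoidData h Q odd_l R ιX K' constEmb constEmb_injective hinvc hinvp).SgpUnique :=
  ⟨sgpCapSpec_ofTemperoidData h Q odd_l R ιX K' constEmb constEmb_injective hinvc hinvp,
    sgpCupSpec_ofTemperoidData h Q odd_l R ιX K' constEmb constEmb_injective hinvc hinvp,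
    sgpUnique_ofTemperoidData h Q odd_l R ιX K' constEmb constEmb_injective hinvc hinvp⟩

/-- **[EtTh] Prop. 4.3 (iii) over `B^temp(Π^tp_X)` (F-0551 `BiKummerDifferenceMem`) modulo the single printed input `hH`**
(`Π^tp_Ÿ ⊆ H_⊙`, §5 p. 322 (PDF p. 96)): abc-iut-L2-t4's `biKummerDifferenceMem_ofBiKummerData` with `hσ` the theorem
`baseMap_strvOfBiKummerData` (`σ = s^trv_N` constructed) and the [FrdI] Thm. 5.2 (ii) dictionary laws `hfrac` / `haut` the theorems
`coe_fracOfModel_mul_unit` / `coe_biratAutModel_eq_pull` (identity dictionary) — the tempered-base twin of abc-iut-w6-d054's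
`biKummerDifferenceMem_ofConnectedTemperoidData`.  [cite: MochizukiEtTh2009, Prop 4.3 (iii) p.317 (PDF p.91); §5 p.331 (PDF p.105)] -/
theorem biKummerDifferenceMem_ofTemperoidData
    (hH : ∀ y : T.PiX, y ∈ T.PiYdd → ιX y ∈ (BiKummerSetting.mkOfTemperoid X tf hZ hP NH A₀ hA₀ hA₀').Hodot) :
    (ofTemperoidData h Q odd_l R ιX K' constEmb constEmb_injective hinvc hinvp).BiKummerDifferenceMem :=
  biKummerDifferenceMem_ofBiKummerData h _ Q odd_l R ιX _ _ K' constEmb constEmb_injective _ _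
    (baseMap_strvOfBiKummerData h R) hH (fun s' s'' _ _ _ => BiKummerSetting.coe_fracOfModel_mul_unit tf T₀.isUnit_BΛ s' s'')
    (fun e x => BiKummerSetting.coe_biratAutModel_eq_pull tf e x)

/-- **Tranche-125 certificate over `B^temp(Π^tp_X)` modulo `hH`**: F-0552 ∧ F-0553 ∧ F-0554 ∧ F-0551 for `ofTemperoidData`.
[cite: MochizukiEtTh2009, §5 p.331 (PDF p.105); Prop 4.3 (iii) p.317 (PDF p.91)] -/
theorem biKummerRows_ofTemperoidData
    (hH : ∀ y : T.PiX, y ∈ T.PiYdd → ιX y ∈ (BiKummerSetting.mkOfTemperoid X tf hZ hP NH A₀ hA₀ hA₀').Hodot) :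
    (ofTemperoidData h Q odd_l R ιX K' constEmb constEmb_injective hinvc hinvp).SgpCapSpec ∧
    (ofTemperoidData h Q odd_l R ιX K' constEmb constEmb_injective hinvc hinvp).SgpCupSpec ∧
    (ofTemperoidData h Q odd_l R ιX K' constEmb constEmb_injective hinvc hinvp).SgpUnique ∧
    (ofTemperoidData h Q odd_l R ιX K' constEmb constEmb_injective hinvc hinvp).BiKummerDifferenceMem :=
  ⟨sgpCapSpec_ofTemperoidData h Q odd_l R ιX K' constEmb constEmb_injective hinvc hinvp,
    sgpCupSpec_ofTemperoidData h Q odd_l R ιX K' constEmb constEmb_injective hinvc hinvp,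
    sgpUnique_ofTemperoidData h Q odd_l R ιX K' constEmb constEmb_injective hinvc hinvp,
    biKummerDifferenceMem_ofTemperoidData h Q odd_l R ιX K' constEmb constEmb_injective hinvc hinvp hH⟩

end OfTemperoidData

end ThetaFrobenioid

/-! ### At every level of the assembled tower of roots (`ThetaFrobenioidTower.levelData N`) -/

namespace ThetaFrobenioidTower

section LevelData

variable {K : Type u₀} [Field K] {X : SemiGraphs.TemperedArithmeticGroup.{u₀} K} {D₀ : Type u₀} [Category.{v₀} D₀]
  {V : FrdIMonoidStub.{w}} {T₀ : RealifiedDivisorMonoids (D₀ := D₀) V} {D : Type u} [Category.{v} D]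
  {VD : FrdICatStub.{u, v, w} D} {S : BiKummerSetting X T₀ D VD}
  {pullFrac : ∀ {A A' : S.C} (_ : A' ⟶ A), S.biratUnits A → S.biratUnits A'}
  {lv : ℕ+} {E : Set ℕ+} {𝒯 : ThetaEnvTower.{max v w} E} {θ : S.biratUnits S.Aodot} {Bl : S.C}
  {Pl : S.FractionPair θ Bl} {Rl : S.NthRoot θ Pl lv pullFrac}
  (h : ModelFrobenioid.Hypotheses S.tf.divisorMonoid S.tf.ratFnFunctor)
  (toB : ∀ A : S.C, S.biratUnits A →* S.tf.biratUnitsModel A) (Q : FrobenioidTheta.ThetaSubquotientStub.{w} D)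
  (odd_l : Odd (lv : ℕ)) (R : ∀ N : ℕ+, S.NthRoot Rl.root Rl.pair N pullFrac) (ιX : 𝒯.PiX ≃ₜ* X.Pi)
  (hopen : ∀ N : ℕ+, IsOpen ((S.galoisSurj (R N).AN.base (R N).αData.isGalois).ker : Set X.Pi))
  (σ : ∀ N : ℕ+, Aut (R N).AN.base →* Aut (R N).AN)
  (K' : Type w) [Field K'] (constEmb : ∀ N : ℕ+, K'ˣ →* S.tf.biratUnitsModel (R N).BN)
  (constEmb_injective : ∀ N : ℕ+, Function.Injective (constEmb N))
  (hdivc : ∀ (N : ℕ+) (g : Aut (R N).BN.base),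
    ModelFrobenioid.div ((σ N ((BiKummerSetting.NthRoot.baseIso S (R N)).conjAut.symm g)).hom ≫ (R N).pair.num) =
      ModelFrobenioid.div (R N).pair.num)
  (hdivp : ∀ (N : ℕ+) (y : 𝒯.PiYdd),
    ModelFrobenioid.div ((σ N (S.galoisSurj (R N).AN.base (R N).αData.isGalois (ιX y.1))).hom ≫ (R N).pair.den) =
      ModelFrobenioid.div (R N).pair.den)

/-- **F-0554 `SgpUnique` at EVERY level `N ≥ 1` of the assembled tower of roots, NO named input** (p. 331 (PDF p. 105)): the
level-`N` data's `s^⊓-gp_N, s^⊔-gp_N` are the unique lifts (`liftAlong`) which SATISFY the defining relations (abc-iut-L2-t4's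
`sgpCapSpec_levelData` / `sgpCupSpec_levelData`), and `s^⊓_N = (R N).pair.num`, `s^⊔_N = (R N).pair.den` are epimorphisms of the model
Frobenioid ([FrdI] Def. 1.3 / Thm. 5.2, `epi_of_model`) — so `sgpUnique_of` applies.  [cite: MochizukiEtTh2009, §5 p.331 (PDF p.105)] -/
theorem sgpUnique_levelData (N : ℕ+) :
    (levelData h toB Q odd_l R ιX hopen σ K' constEmb constEmb_injective hdivc hdivp N).SgpUnique := by
  haveI : Epi (levelData h toB Q odd_l R ιX hopen σ K' constEmb constEmb_injective hdivc hdivp N).sCap :=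
    ThetaFrobenioid.epi_of_model (DivB := S.tf.divBNatTrans) h _
  haveI : Epi (levelData h toB Q odd_l R ιX hopen σ K' constEmb constEmb_injective hdivc hdivp N).sCup :=
    ThetaFrobenioid.epi_of_model (DivB := S.tf.divBNatTrans) h _
  exact ThetaFrobenioid.sgpUnique_of _
    (sgpCapSpec_levelData h toB Q odd_l R ιX hopen σ K' constEmb constEmb_injective hdivc hdivp N)
    (sgpCupSpec_levelData h toB Q odd_l R ιX hopen σ K' constEmb constEmb_injective hdivc hdivp N)

/-- **The p. 331 sentence in full at every level of the tower, NO named input** (F-0552 ∧ F-0553 ∧ F-0554).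
[cite: MochizukiEtTh2009, §5 p.331 (PDF p.105)] -/
theorem sgpSpecs_and_unique_levelData (N : ℕ+) :
    (levelData h toB Q odd_l R ιX hopen σ K' constEmb constEmb_injective hdivc hdivp N).SgpCapSpec ∧
    (levelData h toB Q odd_l R ιX hopen σ K' constEmb constEmb_injective hdivc hdivp N).SgpCupSpec ∧
    (levelData h toB Q odd_l R ιX hopen σ K' constEmb constEmb_injective hdivc hdivp N).SgpUnique :=
  ⟨sgpCapSpec_levelData h toB Q odd_l R ιX hopen σ K' constEmb constEmb_injective hdivc hdivp N,
    sgpCupSpec_levelData h toB Q odd_l R ιX hopen σ K' constEmb constEmb_injective hdivc hdivp N,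
    sgpUnique_levelData h toB Q odd_l R ιX hopen σ K' constEmb constEmb_injective hdivc hdivp N⟩

/-- **Tranche-125 certificate at EVERY level of the assembled tower**: F-0552 ∧ F-0553 ∧ F-0554 ∧ F-0551 for `levelData N`; the
F-0551 conjunct is abc-iut-L2-t4's `biKummerDifferenceMem_levelData` (cited), whose inputs are exactly the inputs here: `hσ` ([FrdI]
Prop. 5.6: `s^trv_N` a section), `hH` (`Π^tp_Ÿ ⊆ H_⊙`, p. 322), `hfrac` / `haut` (the [FrdI] Thm. 5.2 (ii) dictionary laws of `toB`).
[cite: MochizukiEtTh2009, §5 p.331 (PDF p.105); Prop 4.3 (iii) p.317 (PDF p.91)] -/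
theorem biKummerRows_levelData
    (hσ : ∀ (N : ℕ+) (g : Aut (R N).AN.base), ModelFrobenioid.baseMap (σ N g).hom = g.hom)
    (hH : ∀ y : 𝒯.PiX, y ∈ 𝒯.PiYdd → ιX y ∈ S.Hodot)
    (hfrac : ∀ {A B : S.C} (s' s'' : A ⟶ B) (h' : S.IsPreStep s') (h'' : S.IsPreStep s'')
      (hb : PreFrobenioid.BaseEquivalent S.F s' s''),
      (toB A (S.fracOf s' s'' h' h'' hb) : S.tf.ratFnFunctor.obj (op A.base)) * ModelFrobenioid.unit s'' =
        ModelFrobenioid.unit s')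
    (haut : ∀ {A : S.C} (e : Aut A) (x : S.biratUnits A),
      (toB A (S.biratAut A e x) : S.tf.ratFnFunctor.obj (op A.base)) =
        pull S.tf.ratFnFunctor (ModelFrobenioid.baseMap e.inv) (toB A x : S.tf.ratFnFunctor.obj (op A.base)))
    (N : ℕ+) :
    (levelData h toB Q odd_l R ιX hopen σ K' constEmb constEmb_injective hdivc hdivp N).SgpCapSpec ∧
    (levelData h toB Q odd_l R ιX hopen σ K' constEmb constEmb_injective hdivc hdivp N).SgpCupSpec ∧
    (levelData h toB Q odd_l R ιX hopen σ K' constEmb constEmb_injective hdivc hdivp N).SgpUnique ∧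
    (levelData h toB Q odd_l R ιX hopen σ K' constEmb constEmb_injective hdivc hdivp N).BiKummerDifferenceMem :=
  ⟨sgpCapSpec_levelData h toB Q odd_l R ιX hopen σ K' constEmb constEmb_injective hdivc hdivp N,
    sgpCupSpec_levelData h toB Q odd_l R ιX hopen σ K' constEmb constEmb_injective hdivc hdivp N,
    sgpUnique_levelData h toB Q odd_l R ιX hopen σ K' constEmb constEmb_injective hdivc hdivp N,
    biKummerDifferenceMem_levelData h toB Q odd_l R ιX hopen σ K' constEmb constEmb_injective hdivc hdivp hσ hH hfrac haut N⟩

end LevelData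
/-! ### At every level of the tower over `B^temp(Π^tp_X)⁰` (`ofConnectedTemperoidFamily`) -/

section ConnectedFamily

variable {K : Type u₀} [Field K] {X : SemiGraphs.TemperedArithmeticGroup.{u₀} K} {D₀ : Type u₀} [Category.{v₀} D₀]
  {V : FrdIMonoidStub.{w}} {T₀ : RealifiedDivisorMonoids (D₀ := D₀) V}
  {VD : FrdICatStub.{u₀ + 1, u₀, w} (ConnectedPart (BTemp X.Pi))}
  {tf : TemperedFrobenioid T₀ (ConnectedPart (BTemp X.Pi)) VD} {hZ : tf.monoidType = MonoidType.Z}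
  {hP : ∀ A : (ConnectedPart (BTemp X.Pi))ᵒᵖ, IsPerfect (tf.Φ.carrier A)}
  {NH : Subgroup (Field.absoluteGaloisGroup K) → tf.category → ℕ+ → Prop} {A₀ : tf.category}
  {hA₀ : PreFrobenioid.IsFrobeniusTrivial tf.toElem A₀} {hA₀' : SemiGraphs.IsGaloisObj A₀.base.obj}
  {pullFrac : ∀ {A A' : (BiKummerSetting.mkOfConnectedTemperoid X tf hZ hP NH A₀ hA₀ hA₀').C} (_ : A' ⟶ A),
    (BiKummerSetting.mkOfConnectedTemperoid X tf hZ hP NH A₀ hA₀ hA₀').biratUnits A →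
      (BiKummerSetting.mkOfConnectedTemperoid X tf hZ hP NH A₀ hA₀ hA₀').biratUnits A'}
  {lv : ℕ+} {E : Set ℕ+} {𝒯 : ThetaEnvTower.{max u₀ w} E}
  {θ : (BiKummerSetting.mkOfConnectedTemperoid X tf hZ hP NH A₀ hA₀ hA₀').biratUnits
    (BiKummerSetting.mkOfConnectedTemperoid X tf hZ hP NH A₀ hA₀ hA₀').Aodot}
  {Bl : (BiKummerSetting.mkOfConnectedTemperoid X tf hZ hP NH A₀ hA₀ hA₀').C}
  {Pl : (BiKummerSetting.mkOfConnectedTemperoid X tf hZ hP NH A₀ hA₀ hA₀').FractionPair θ Bl}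
  {Rl : (BiKummerSetting.mkOfConnectedTemperoid X tf hZ hP NH A₀ hA₀ hA₀').NthRoot θ Pl lv pullFrac}
  (h : ModelFrobenioid.Hypotheses tf.divisorMonoid tf.ratFnFunctor)
  (Q : FrobenioidTheta.ThetaSubquotientStub.{w} (ConnectedPart (BTemp X.Pi))) (odd_l : Odd (lv : ℕ))
  (R : ∀ N : ℕ+, (BiKummerSetting.mkOfConnectedTemperoid X tf hZ hP NH A₀ hA₀ hA₀').NthRoot Rl.root Rl.pair N pullFrac)
  (ιX : 𝒯.PiX ≃ₜ* X.Pi) (K' : Type w) [Field K'] (constEmb : ∀ N : ℕ+, K'ˣ →* tf.biratUnitsModel (R N).BN)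
  (constEmb_injective : ∀ N : ℕ+, Function.Injective (constEmb N))
  (hinvc : ∀ (N : ℕ+) (g : Aut (R N).AN.base),
    pull tf.divisorMonoid g.hom (ModelFrobenioid.div (R N).pair.num) = ModelFrobenioid.div (R N).pair.num)
  (hinvp : ∀ (N : ℕ+) (y : 𝒯.PiX), y ∈ 𝒯.PiYdd →
    pull tf.divisorMonoid ((BiKummerSetting.mkOfConnectedTemperoid X tf hZ hP NH A₀ hA₀ hA₀').galoisSurj (R N).AN.base
      (R N).αData.isGalois (ιX y)).hom (ModelFrobenioid.div (R N).pair.den) = ModelFrobenioid.div (R N).pair.den)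
  (α : ∀ {N N' : ℕ+}, (N : ℕ) ∣ N' → ((R N').AN ⟶ (R N).AN))
  (β : ∀ {N N' : ℕ+}, (N : ℕ) ∣ N' → ((R N').BN ⟶ (R N).BN))
  (comm_sCap : ∀ {N N' : ℕ+} (hd : (N : ℕ) ∣ N'), (R N').pair.num ≫ β hd = α hd ≫ (R N).pair.num)
  (comm_sCup : ∀ {N N' : ℕ+} (hd : (N : ℕ) ∣ N'), (R N').pair.den ≫ β hd = α hd ≫ (R N).pair.den)
  (isIsometry_α : ∀ {N N' : ℕ+} (hd : (N : ℕ) ∣ N'),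
    ((BiKummerSetting.mkOfConnectedTemperoid X tf hZ hP NH A₀ hA₀ hA₀').sec5Stub h).pre.IsIsometry (α hd))
  (degFr_α : ∀ {N N' : ℕ+} (hd : (N : ℕ) ∣ N'),
    (((BiKummerSetting.mkOfConnectedTemperoid X tf hZ hP NH A₀ hA₀ hA₀').sec5Stub h).pre.degFr (α hd) : ℕ) * N = N')
  (isIsometry_β : ∀ {N N' : ℕ+} (hd : (N : ℕ) ∣ N'),
    ((BiKummerSetting.mkOfConnectedTemperoid X tf hZ hP NH A₀ hA₀ hA₀').sec5Stub h).pre.IsIsometry (β hd))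
  (degFr_β : ∀ {N N' : ℕ+} (hd : (N : ℕ) ∣ N'),
    (((BiKummerSetting.mkOfConnectedTemperoid X tf hZ hP NH A₀ hA₀ hA₀').sec5Stub h).pre.degFr (β hd) : ℕ) * N = N')
  (baseFrob_α : ∀ {N N' : ℕ+} (hd : (N : ℕ) ∣ N'),
    (BiKummerSetting.mkOfConnectedTemperoid X tf hZ hP NH A₀ hA₀ hA₀').IsOfBaseFrobeniusType (α hd))

/-- **F-0554 `SgpUnique` at EVERY level of the §5 tower over the GENUINE connected base `B^temp(Π^tp_X)⁰`, NO named input** (the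
level-`N` data of `ofConnectedTemperoidFamily` IS `levelData N` with the discharged arguments, `atLevel_ofBiKummerFamily`).
[cite: MochizukiEtTh2009, §5 p.331 (PDF p.105)] -/
theorem sgpUnique_atLevel_ofConnectedTemperoidFamily (N : ℕ+) :
    ((ofConnectedTemperoidFamily h Q odd_l R ιX K' constEmb constEmb_injective hinvc hinvp α β comm_sCap comm_sCup isIsometry_α
        degFr_α isIsometry_β degFr_β baseFrob_α).atLevel N).SgpUnique := by
  delta ofConnectedTemperoidFamily
  rw [atLevel_ofBiKummerFamily (K' := K') (ρ_comm_β := fun hd => rho_comm_β_of_natural R ιX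
      (BiKummerSetting.mkOfConnectedTemperoid_galoisSurj_natural X tf hZ hP NH A₀ hA₀ hA₀') α β comm_sCap hd)]
  exact sgpUnique_levelData _ _ _ _ _ _ _ _ _ _ _ _ _ N

/-- **Tranche-125 certificate at EVERY level of the §5 tower over `B^temp(Π^tp_X)⁰` modulo `hH`** (F-0552 ∧ F-0553 ∧ F-0554 ∧ F-0551):
`hσ` is the theorem `baseMap_strvOfBiKummerData`, `hfrac` / `haut` the identity-dictionary theorems `coe_fracOfModel_mul_unit` /
`coe_biratAutModel_eq_pull`.  [cite: MochizukiEtTh2009, §5 p.331 (PDF p.105); Prop 4.3 (iii) p.317 (PDF p.91)] -/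
theorem biKummerRows_atLevel_ofConnectedTemperoidFamily
    (hH : ∀ y : 𝒯.PiX, y ∈ 𝒯.PiYdd → ιX y ∈ (BiKummerSetting.mkOfConnectedTemperoid X tf hZ hP NH A₀ hA₀ hA₀').Hodot) (N : ℕ+) :
    ((ofConnectedTemperoidFamily h Q odd_l R ιX K' constEmb constEmb_injective hinvc hinvp α β comm_sCap comm_sCup isIsometry_α
        degFr_α isIsometry_β degFr_β baseFrob_α).atLevel N).SgpCapSpec ∧
    ((ofConnectedTemperoidFamily h Q odd_l R ιX K' constEmb constEmb_injective hinvc hinvp α β comm_sCap comm_sCup isIsometry_α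
        degFr_α isIsometry_β degFr_β baseFrob_α).atLevel N).SgpCupSpec ∧
    ((ofConnectedTemperoidFamily h Q odd_l R ιX K' constEmb constEmb_injective hinvc hinvp α β comm_sCap comm_sCup isIsometry_α
        degFr_α isIsometry_β degFr_β baseFrob_α).atLevel N).SgpUnique ∧
    ((ofConnectedTemperoidFamily h Q odd_l R ιX K' constEmb constEmb_injective hinvc hinvp α β comm_sCap comm_sCup isIsometry_α
        degFr_α isIsometry_β degFr_β baseFrob_α).atLevel N).BiKummerDifferenceMem := by
  delta ofConnectedTemperoidFamily
  rw [atLevel_ofBiKummerFamily (K' := K') (ρ_comm_β := fun hd => rho_comm_β_of_natural R ιX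
      (BiKummerSetting.mkOfConnectedTemperoid_galoisSurj_natural X tf hZ hP NH A₀ hA₀ hA₀') α β comm_sCap hd)]
  exact biKummerRows_levelData _ _ _ _ _ _ _ _ _ _ _ _ _
    (fun N g => ThetaFrobenioid.baseMap_strvOfBiKummerData h (R N) g) hH
    (fun s' s'' _ _ _ => BiKummerSetting.coe_fracOfModel_mul_unit tf T₀.isUnit_BΛ s' s'')
    (fun e x => BiKummerSetting.coe_biratAutModel_eq_pull tf e x) N

end ConnectedFamily

end ThetaFrobenioidTower

end Literature.AnabelianGeometry.EtaleTheta

end
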